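/-
Origin: expansion seat `planner-pub-hodgecm-mc-theta-3-g13-0`, handover (K10) 2026-08-20T10:07:15Z md5 95135ce1852b44be93056f1d284c2ffd (222 l., 21 decls; NEW additive drop-alone leaf over RUN-45 (TD) `ArchSlotDeltaDischarge` + RUN-47 #1218 `ArchLineSlotTypeConjClosed`; μ♯♯ adapter: (μ, hΔ₁, hΔ₂, hΔ₃) of the E term from ONE hyp hSV = (STRIP) ∧ (VT); cert rc 0/0 warn/0 proof holes; axioms 21/21 ⊆ trio) (`HOME/mc/pub-hodgecm-mc-theta-3-g13/lean/stage48/HodgeCM/Model/ArchSlotDeltaDischarge23.lean`, md5 95135ce1852b, 222 lines);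
landed by the second packager p2 gen 6 (p2-g6) in gate run 48 as `HodgeCM/Model/ArchSlotDeltaDischarge23.lean` (verbatim).
-/
/-
Origin: speedrun cell pub-hodgecm, MODEL-CONSTRUCTION sub-cell, lineage mc-theta-3 (theta supply / second-lift lane, BINDER-OWNERS row 5 `S` slot),
seat planner-pub-hodgecm-mc-theta-3-g13-0 (gen 13), 2026-08-20.  Target in PKG: `HodgeCM/Model/ArchSlotDeltaDischarge23.lean`
(NEW additive drop-alone leaf; imports this seat's RUN-45 (TD) `Model/ArchSlotDeltaDischarge` and sinst-1's RUN-47 #1218 `Model/ArchLineSlotTypeConjClosed`).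
KERNEL only: 0 records / Prop-valued definitions / cites, 0 proof holes; intended closure {propext, Classical.choice, Quot.sound}.
-/
import Summits.HodgeConjecture.HodgeCM.Model.ArchSlotDeltaDischarge
import Summits.HodgeConjecture.HodgeCM.Model.ArchLineSlotTypeConjClosed

/-!
# (J-μ) `hΔ₂`, `hΔ₃` IN E's OWN SHAPE MODULO ONE ANALYTIC INPUT: the adapter `μ♯♯`

E's (J-μ) binder group of record (#395 / #1212 `SInstance.SROG`, glue-1's `_r21AEOGIS…` chain) is the datum
`μ : SeesawCtx L → Fin 4 → InfinitePlace L → ℤ` with three guarded identities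
`hΔₖ : ∀ V c, ∀ hc : GOG V c, slotTypeVec … k − slotTypeVec … 0 = μ c k − μ c 0` (`k = 1, 2, 3`).
(TD) discharged `hΔ₁` at `μ♯ c := update (μ c) 1 (μ c 0 + slotDelta c.D)`.  For the cross-plane slots `k = 2, 3`, sinst-1's #1218
`slotTypeVec_two/three_sub_zero_apply_of_strip_vt` computes the differences in closed form MODULO the two analytic inputs (STRIP) `hstrip`
and (VT) `hY` of #1217 (the archimedean factor of the conjugated see-saw tensor and its vacuum transport through theta-3's (K7)
`conjTransportK c.D`): `Δ₂(w) = [conjSwapAt c.D w] · slotDelta c.D w`, `Δ₃(w) = [¬ conjSwapAt c.D w] · slotDelta c.D w`.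

This leaf packages that, exactly as (TD) did for slot 1:

* §1 the `V`-free, `ι₁`-free closed tables `slotDelta₂ S`, `slotDelta₃ S` (`slotDelta₂ + slotDelta₃ = slotDelta`);
* §2 **`μ♯♯ c := update (update (μ♯ c) 2 (μ c 0 + slotDelta₂ c.D)) 3 (μ c 0 + slotDelta₃ c.D)`** (`muSharp₂₃`; entries `0, 1` are those of `μ♯`);
* §3 in E's binder shape: `hΔ₁_GOG_muSharp₂₃` HYPOTHESIS-FREE ((TD) transferred), and `hΔ₂_GOG_muSharp₂₃`, `hΔ₃_GOG_muSharp₂₃` under ONE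
  ∀-packaged hypothesis `hSV` = «for every guarded `(V, c)` there are `Y, F, a` with (STRIP) and (VT)» — the statement the period lane's
  stripping leaf and the (VT) steps W1–W6 prove; the binder texts inside `hSV` are #1217's `hstrip` / `hY` verbatim with the guard's
  positivity facts `hpos_GOG` and the splitting family `hGR V c` substituted.

So an E-shaped term taking `(μ, hΔ₁, hΔ₂, hΔ₃)` is fed `(μ♯♯, hΔ₁_GOG_muSharp₂₃ …, hΔ₂_GOG_muSharp₂₃ … hSV, hΔ₃_GOG_muSharp₂₃ … hSV)`:
the whole (J-μ) group reduces to the single input `hSV`.  Nothing here is a claim of PerL/QW8; nothing is cited.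

Self-description erratum for (K7), normalised here per mc-ref W-R25.1 (never in place): (K7) `Model/ArchConjTorusTransport`'s header says
«0 `def … : Prop`», but its `conjSwapAt S w : Prop := ¬ ((0 < (w (dW S 0)).re) ↔ (0 < (w (dW' S 0)).re))` IS a `Prop`-valued definition — a
decidable sign-relabelling BIT of the datum (used under `if` here and in #1218), not a statement, record, hypothesis or claim.  This leaf
defines no `Prop`-valued constant.
-/

set_option autoImplicit false

noncomputable section

open scoped Matrix Classical SchwartzMap TensorProduct
open NumberField.mixedEmbedding (mixedSpace)
open Literature.NumberTheory.Automorphic Literature.NumberTheory.Automorphic.UnitaryGroup Literature.NumberTheory.Weil1964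
open Literature.NumberTheory.GelbartRogawski1991 Literature.NumberTheory.GelbartRogawski1991.UnitaryDualPair
open HodgeCM.Adelic HodgeCM.PerL34
open HodgeCM.Model.HypCensus

namespace HodgeCM.Model.ArchSideTerm

/-! ## §1 the closed tables of slots 2 and 3 -/

section Tables

variable {L : CMField} (S : StubTree.SeesawDatum L)

/-- **`δ₂_S`**: `slotDelta S` at the places where (K7)'s relabelling bit is set, `0` elsewhere. -/
def slotDelta₂ (w : NumberField.InfinitePlace (L : Type)) : ℤ :=
  if conjSwapAt S w then slotDelta S w else 0

/-- **`δ₃_S`**: `slotDelta S` at the places where (K7)'s relabelling bit is NOT set, `0` elsewhere. -/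
def slotDelta₃ (w : NumberField.InfinitePlace (L : Type)) : ℤ :=
  if conjSwapAt S w then 0 else slotDelta S w

/-- (Ported verbatim from the HodgeCMPerL package; no docstring in the source.) -/
theorem slotDelta₂_of_conjSwapAt {w : NumberField.InfinitePlace (L : Type)} (h : conjSwapAt S w) : slotDelta₂ S w = slotDelta S w :=
  if_pos h

/-- (Ported verbatim from the HodgeCMPerL package; no docstring in the source.) -/
theorem slotDelta₂_of_not_conjSwapAt {w : NumberField.InfinitePlace (L : Type)} (h : ¬ conjSwapAt S w) : slotDelta₂ S w = 0 :=
  if_neg h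

/-- (Ported verbatim from the HodgeCMPerL package; no docstring in the source.) -/
theorem slotDelta₃_of_conjSwapAt {w : NumberField.InfinitePlace (L : Type)} (h : conjSwapAt S w) : slotDelta₃ S w = 0 :=
  if_pos h

/-- (Ported verbatim from the HodgeCMPerL package; no docstring in the source.) -/
theorem slotDelta₃_of_not_conjSwapAt {w : NumberField.InfinitePlace (L : Type)} (h : ¬ conjSwapAt S w) : slotDelta₃ S w = slotDelta S w :=
  if_neg h

/-- the two tables partition `slotDelta`. -/
theorem slotDelta₂_add_slotDelta₃ (w : NumberField.InfinitePlace (L : Type)) : slotDelta₂ S w + slotDelta₃ S w = slotDelta S w := by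
  unfold slotDelta₂ slotDelta₃
  split_ifs <;> simp

/-- at most one of the two tables is non-zero at a place. -/
theorem slotDelta₂_mul_slotDelta₃ (w : NumberField.InfinitePlace (L : Type)) : slotDelta₂ S w * slotDelta₃ S w = 0 := by
  unfold slotDelta₂ slotDelta₃
  split_ifs <;> simp

end Tables

/-! ## §2 the adapter `μ♯♯` -/

/-- **`μ♯♯`**: E's slot table with entries `1, 2, 3` re-set to `μ c 0 + slotDelta c.D`, `μ c 0 + slotDelta₂ c.D`, `μ c 0 + slotDelta₃ c.D`. -/
def muSharp₂₃ (μ : ∀ {L : CMField}, SeesawCtx L → Fin 4 → NumberField.InfinitePlace L → ℤ) {L : CMField} (c : SeesawCtx L) :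
    Fin 4 → NumberField.InfinitePlace (L : Type) → ℤ :=
  Function.update (Function.update (muSharp μ c) 2 (μ c 0 + slotDelta₂ c.D)) 3 (μ c 0 + slotDelta₃ c.D)

section Adapter

variable (μ : ∀ {L : CMField}, SeesawCtx L → Fin 4 → NumberField.InfinitePlace L → ℤ) {L : CMField} (c : SeesawCtx L)

/-- (Ported verbatim from the HodgeCMPerL package; no docstring in the source.) -/
theorem muSharp₂₃_three : muSharp₂₃ μ c 3 = μ c 0 + slotDelta₃ c.D :=
  Function.update_self _ _ _

/-- (Ported verbatim from the HodgeCMPerL package; no docstring in the source.) -/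
theorem muSharp₂₃_two : muSharp₂₃ μ c 2 = μ c 0 + slotDelta₂ c.D := by
  rw [muSharp₂₃, Function.update_of_ne (by decide : (2 : Fin 4) ≠ 3), Function.update_self]

/-- entries `0` and `1` are those of `μ♯`. -/
theorem muSharp₂₃_eq_muSharp {k : Fin 4} (hk₂ : k ≠ 2) (hk₃ : k ≠ 3) : muSharp₂₃ μ c k = muSharp μ c k := by
  rw [muSharp₂₃, Function.update_of_ne hk₃, Function.update_of_ne hk₂]

/-- (Ported verbatim from the HodgeCMPerL package; no docstring in the source.) -/
theorem muSharp₂₃_zero : muSharp₂₃ μ c 0 = μ c 0 := by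
  rw [muSharp₂₃_eq_muSharp μ c (by decide) (by decide), muSharp_of_ne_one μ c (by decide)]

/-- (Ported verbatim from the HodgeCMPerL package; no docstring in the source.) -/
theorem muSharp₂₃_one : muSharp₂₃ μ c 1 = μ c 0 + slotDelta c.D := by
  rw [muSharp₂₃_eq_muSharp μ c (by decide) (by decide), muSharp_one]

/-- (Ported verbatim from the HodgeCMPerL package; no docstring in the source.) -/
theorem muSharp₂₃_one_sub_zero : muSharp₂₃ μ c 1 - muSharp₂₃ μ c 0 = slotDelta c.D := by
  rw [muSharp₂₃_one, muSharp₂₃_zero, add_sub_cancel_left]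

/-- (Ported verbatim from the HodgeCMPerL package; no docstring in the source.) -/
theorem muSharp₂₃_two_sub_zero : muSharp₂₃ μ c 2 - muSharp₂₃ μ c 0 = slotDelta₂ c.D := by
  rw [muSharp₂₃_two, muSharp₂₃_zero, add_sub_cancel_left]

/-- (Ported verbatim from the HodgeCMPerL package; no docstring in the source.) -/
theorem muSharp₂₃_three_sub_zero : muSharp₂₃ μ c 3 - muSharp₂₃ μ c 0 = slotDelta₃ c.D := by
  rw [muSharp₂₃_three, muSharp₂₃_zero, add_sub_cancel_left]

end Adapter

/-! ## §3 E's binder shape -/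

section E

variable
  (hGR : ∀ {L : CMField} {ι₁ : L →+* ℂ} (V : HermSpace3 L ι₁) (c : SeesawCtx L),
    (cmSplittingDatum (L : Type) finProdFinEquiv (frameD V) (frameD_real V) (frameD_ne V) (dW c.D) (dW_real c.D)
      (dW_ne c.D)).CompatibleSplitting)
  (hGR₀ : ∀ {L : CMField} {ι₁ : L →+* ℂ} (V : HermSpace3 L ι₁) (c : SeesawCtx L),
    (cmSplittingDatum (L : Type) (e₁) (frameD V) (frameD_real V) (frameD_ne V) (lineVec (L : Type) (dW c.D 0))
      (fun _ => dW_real c.D 0) (fun _ => dW_ne c.D 0)).CompatibleSplitting)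
  (hGR₁ : ∀ {L : CMField} {ι₁ : L →+* ℂ} (V : HermSpace3 L ι₁) (c : SeesawCtx L),
    (cmSplittingDatum (L : Type) (e₁) (frameD V) (frameD_real V) (frameD_ne V) (lineVec (L : Type) (dW c.D 1))
      (fun _ => dW_real c.D 1) (fun _ => dW_ne c.D 1)).CompatibleSplitting)
  (hGR₂ : ∀ {L : CMField} {ι₁ : L →+* ℂ} (V : HermSpace3 L ι₁) (c : SeesawCtx L),
    (cmSplittingDatum (L : Type) (e₁) (frameD V) (frameD_real V) (frameD_ne V) (lineVec (L : Type) (dW' c.D 0))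
      (fun _ => dW'_real c.D 0) (fun _ => dW'_ne c.D 0)).CompatibleSplitting)
  (hGR₃ : ∀ {L : CMField} {ι₁ : L →+* ℂ} (V : HermSpace3 L ι₁) (c : SeesawCtx L),
    (cmSplittingDatum (L : Type) (e₁) (frameD V) (frameD_real V) (frameD_ne V) (lineVec (L : Type) (dW' c.D 1))
      (fun _ => dW'_real c.D 1) (fun _ => dW'_ne c.D 1)).CompatibleSplitting)
  (μ : ∀ {L : CMField}, SeesawCtx L → Fin 4 → NumberField.InfinitePlace L → ℤ)

/-- **`hΔ₁` OF E AT `μ♯♯` — HYPOTHESIS-FREE** ((TD) `hΔ₁_GOG_muSharp`, entries `0, 1` unchanged). -/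
theorem hΔ₁_GOG_muSharp₂₃ : ∀ {L : CMField} {ι₁ : L →+* ℂ} (V : HermSpace3 L ι₁) (c : SeesawCtx L), ∀ hc : SInstance.GOG V c,
    slotTypeVec V c (hGR V c) (hGR₀ V c) (hGR₁ V c) (hGR₂ V c) (hGR₃ V c) (SInstance.hG_GOG V c hc) 1 -
      slotTypeVec V c (hGR V c) (hGR₀ V c) (hGR₁ V c) (hGR₂ V c) (hGR₃ V c) (SInstance.hG_GOG V c hc) 0 =
        muSharp₂₃ μ c 1 - muSharp₂₃ μ c 0 :=
  fun V c hc => (hΔ₁_GOG_muSharp hGR hGR₀ hGR₁ hGR₂ hGR₃ μ V c hc).trans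
    ((muSharp_one_sub_zero μ c).trans (muSharp₂₃_one_sub_zero μ c).symm)

variable
  (hSV : ∀ {L : CMField} {ι₁ : L →+* ℂ} (V : HermSpace3 L ι₁) (c : SeesawCtx L) (hc : SInstance.GOG V c),
    ∃ (Y : 𝓢((Fin (3 * 2) → mixedSpace (↥(NumberField.maximalRealSubfield (L : Type)))), ℂ))
      (F : FinSB (↥(NumberField.maximalRealSubfield (L : Type))) (Fin (3 * 2))) (a : ℂ),
      cmConjLineTensorFin (L : Type) finProdFinEquiv e₁ (frameD V) (frameD_real V) (frameD_ne V) (dW c.D) (dW_real c.D) (dW_ne c.D)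
          (dW' c.D) (dW'_real c.D) (dW'_ne c.D) c.D.isoGL (isoGL_hg₀ c.D)
          (SupplyInstance.testFun (↥(NumberField.maximalRealSubfield (L : Type))) (Fin 3)
            (linePhi V (dW' c.D 0) (dW'_real c.D 0) (dW'_ne c.D 0) (SInstance.hpos_GOG V c hc).2.2.1)
            (lineX₀ V (dW' c.D 0) (dW'_real c.D 0) (dW'_ne c.D 0) (SInstance.hpos_GOG V c hc).2.2.1) 1)
          (SupplyInstance.testFun (↥(NumberField.maximalRealSubfield (L : Type))) (Fin 3)
            (linePhi V (dW' c.D 1) (dW'_real c.D 1) (dW'_ne c.D 1) (SInstance.hpos_GOG V c hc).2.2.2)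
            (lineX₀ V (dW' c.D 1) (dW'_real c.D 1) (dW'_ne c.D 1) (SInstance.hpos_GOG V c hc).2.2.2) 1) =
        piSchwartzBruhatEquiv (↥(NumberField.maximalRealSubfield (L : Type))) (Fin (3 * 2)) (Y ⊗ₜ F) ∧
      Y = a • HypCensus.cmArchWeilRep (L : Type) finProdFinEquiv (frameD V) (frameD_real V) (frameD_ne V) (dW c.D) (dW_real c.D) (dW_ne c.D)
        (hGR V c) (1, conjTransportK c.D) (ctxSlotArchBox V c (SInstance.hpos_GOG V c hc).1 (SInstance.hpos_GOG V c hc).2.1))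

include hSV in
/-- **`hΔ₂` OF E AT `μ♯♯` MODULO `hSV`** (binder text of #395 / #1212 `SInstance.SROG` verbatim with `μ ↦ μ♯♯`). -/
theorem hΔ₂_GOG_muSharp₂₃ : ∀ {L : CMField} {ι₁ : L →+* ℂ} (V : HermSpace3 L ι₁) (c : SeesawCtx L), ∀ hc : SInstance.GOG V c,
    slotTypeVec V c (hGR V c) (hGR₀ V c) (hGR₁ V c) (hGR₂ V c) (hGR₃ V c) (SInstance.hG_GOG V c hc) 2 -
      slotTypeVec V c (hGR V c) (hGR₀ V c) (hGR₁ V c) (hGR₂ V c) (hGR₃ V c) (SInstance.hG_GOG V c hc) 0 =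
        muSharp₂₃ μ c 2 - muSharp₂₃ μ c 0 := by
  intro L ι₁ V c hc
  obtain ⟨Y, F, a, hstrip, hY⟩ := hSV V c hc
  rw [muSharp₂₃_two_sub_zero]
  funext w
  rw [Pi.sub_apply, slotTypeVec_two_sub_zero_apply_of_strip_vt V c (hGR V c) (hGR₀ V c) (hGR₁ V c) (hGR₂ V c) (hGR₃ V c)
    (SInstance.hG_GOG V c hc) (SInstance.hpos_GOG V c hc).1 (SInstance.hpos_GOG V c hc).2.1 (SInstance.hpos_GOG V c hc).2.2.1
    (SInstance.hpos_GOG V c hc).2.2.2 Y F hstrip a hY w]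
  rfl

include hSV in
/-- **`hΔ₃` OF E AT `μ♯♯` MODULO `hSV`.** -/
theorem hΔ₃_GOG_muSharp₂₃ : ∀ {L : CMField} {ι₁ : L →+* ℂ} (V : HermSpace3 L ι₁) (c : SeesawCtx L), ∀ hc : SInstance.GOG V c,
    slotTypeVec V c (hGR V c) (hGR₀ V c) (hGR₁ V c) (hGR₂ V c) (hGR₃ V c) (SInstance.hG_GOG V c hc) 3 -
      slotTypeVec V c (hGR V c) (hGR₀ V c) (hGR₁ V c) (hGR₂ V c) (hGR₃ V c) (SInstance.hG_GOG V c hc) 0 =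
        muSharp₂₃ μ c 3 - muSharp₂₃ μ c 0 := by
  intro L ι₁ V c hc
  obtain ⟨Y, F, a, hstrip, hY⟩ := hSV V c hc
  rw [muSharp₂₃_three_sub_zero]
  funext w
  rw [Pi.sub_apply, slotTypeVec_three_sub_zero_apply_of_strip_vt V c (hGR V c) (hGR₀ V c) (hGR₁ V c) (hGR₂ V c) (hGR₃ V c)
    (SInstance.hG_GOG V c hc) (SInstance.hpos_GOG V c hc).1 (SInstance.hpos_GOG V c hc).2.1 (SInstance.hpos_GOG V c hc).2.2.1
    (SInstance.hpos_GOG V c hc).2.2.2 Y F hstrip a hY w]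
  rfl

include hSV in
/-- **the three differences at once**: under `hSV`, E's `(hΔ₁, hΔ₂, hΔ₃)` all hold at `μ♯♯`. -/
theorem hΔ_GOG_muSharp₂₃ : ∀ {L : CMField} {ι₁ : L →+* ℂ} (V : HermSpace3 L ι₁) (c : SeesawCtx L), ∀ hc : SInstance.GOG V c,
    ∀ k : Fin 4, k ≠ 0 →
      slotTypeVec V c (hGR V c) (hGR₀ V c) (hGR₁ V c) (hGR₂ V c) (hGR₃ V c) (SInstance.hG_GOG V c hc) k -
        slotTypeVec V c (hGR V c) (hGR₀ V c) (hGR₁ V c) (hGR₂ V c) (hGR₃ V c) (SInstance.hG_GOG V c hc) 0 =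
          muSharp₂₃ μ c k - muSharp₂₃ μ c 0 := by
  intro L ι₁ V c hc k hk
  fin_cases k
  · exact absurd rfl hk
  · exact hΔ₁_GOG_muSharp₂₃ hGR hGR₀ hGR₁ hGR₂ hGR₃ μ V c hc
  · exact hΔ₂_GOG_muSharp₂₃ hGR hGR₀ hGR₁ hGR₂ hGR₃ μ hSV V c hc
  · exact hΔ₃_GOG_muSharp₂₃ hGR hGR₀ hGR₁ hGR₂ hGR₃ μ hSV V c hc

end E

end HodgeCM.Model.ArchSideTerm

end
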